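import Summits.NavierStokesRegularity.NavierStokesRegularity.Theorems.ExtremiserTransienceLerayPincerStrongPointBudget
import Literature.Analysis.FluidPDE.AxisymNoSwirlTaoBounds
import HarnessLib

/-!
# Route `ExtremiserTransience`, crux `NearExtremalTransiencePerFlow` (stmt-NavierStokesRegularity-26567) —
# LINE g11-α «Leray pincer» (ns-idea-5 g11): THE BOUNDED CROWD (step (i) of the static stub T `TightOfBoundedBudget`)

`--supports stmt-NavierStokesRegularity-26567` (helper; prover seat ns-net-p2 g11).  `strongPoints_card_le`: for all `η, Z̄, B, A > 0`
there are `N₀ ∈ ℕ` and `D > 0` such that for every smooth divergence-free `v` with `‖v‖ ≤ 1`, `‖Dv‖ ≤ B`, enstrophy `≤ Z̄`, finite `Ḣ¹`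
budget and linear local-energy growth `A`, every `2D`-separated finite family of `η`-strong points (`‖v x‖ ≥ η`) has at most `N₀`
members — the «BOUNDED CROWD» of the line's mechanism (i) (card: «the strong set is covered by `≤ N₀ = Z̄/c` balls»), immediate from the
strong-point floor `strongPointBudget_holds` (sibling file): the balls `B(x, D)` are pairwise disjoint (`Metric.ball_disjoint_ball`), each
carries `≥ c` (`StrongPointBudget`), and their union carries at most the total enstrophy (`integral_biUnion_finset`,
`setIntegral_le_integral`; integrability of `‖curl v‖²` from the `Ḣ¹` budget, `integrable_norm_curl_sq`), so `card · c ≤ Z̄` and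
`N₀ = ⌈Z̄/c⌉₊`.  HONEST FRAMING: elementary; T, Q♭, ⟨26567⟩ and NS regularity remain OPEN; no summit is proved by a line. [folklore]
-/

noncomputable section

open scoped Topology InnerProductSpace RealInnerProductSpace ENNReal ContDiff
open MeasureTheory Filter Set Metric Function
open Literature.Analysis Literature.Analysis.FluidPDE

namespace Summit.NavierStokesRegularity.NavierStokesRegularity.Theorems

-- the problem directory repeats the summit name (`NavierStokesRegularity/NavierStokesRegularity`)
set_option linter.dupNamespace false

namespace NearExtremalTransiencePerFlow.LerayPincer

section Crowd

/-- **Bounded crowd.**  Given the strong-point floor, `2D`-separated families of `η`-strong points of a field with enstrophy `≤ Z̄`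
are finite with at most `N₀(η, Z̄, B, A)` members: the balls `B(x, D)` are disjoint and each carries enstrophy `≥ c`. [folklore] -/
theorem strongPoints_card_le :
    ∀ (η Zb B A : ℝ), 0 < η → 0 < Zb → 0 < B → 0 < A →
    ∃ (N₀ : ℕ) (D : ℝ), 0 < D ∧
      ∀ (v : EuclideanSpace ℝ (Fin 3) → EuclideanSpace ℝ (Fin 3)), ContDiff ℝ (⊤ : ℕ∞) v → VectorCalculus.IsDivFree v →
        (∀ x, ‖v x‖ ≤ 1) →
        (∀ x, ‖fderiv ℝ v x‖ ≤ B) → (∫ x, ‖curl v x‖ ^ 2 ≤ Zb) → (∫⁻ x, ‖iteratedFDeriv ℝ 1 v x‖ₑ ^ 2 < ⊤) →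
        (∀ (x : EuclideanSpace ℝ (Fin 3)) (R : ℝ), 0 < R → ∫ z in Metric.ball x R, ‖v z‖ ^ 2 ≤ A * R) →
        ∀ S : Finset (EuclideanSpace ℝ (Fin 3)), (∀ x ∈ S, η ≤ ‖v x‖) →
          (S : Set (EuclideanSpace ℝ (Fin 3))).Pairwise (fun x y => 2 * D ≤ dist x y) → S.card ≤ N₀ := by
  intro η Zb B A hη hZb hB hA
  obtain ⟨c, D, hc, hD, hfloor⟩ := strongPointBudget_holds η Zb B A hη hZb hB hA
  refine ⟨⌈Zb / c⌉₊, D, hD, ?_⟩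
  intro v hv hdiv hv1 hDv hZ h1 hgr S hS hsep
  have hωint : Integrable (fun x => ‖curl v x‖ ^ 2) (volume : Measure (EuclideanSpace ℝ (Fin 3))) :=
    (integrable_norm_curl_sq (hv.of_le (by norm_cast)) h1).1
  -- the balls are pairwise disjoint
  have hdisj : (S : Set (EuclideanSpace ℝ (Fin 3))).Pairwise (Disjoint on fun x => Metric.ball x D) := by
    intro x hx y hy hxy
    exact Metric.ball_disjoint_ball (by have := hsep hx hy hxy; linarith)
  -- sum of the local budgets = budget of the union ≤ total enstrophy
  have hsum : ∑ x ∈ S, ∫ z in Metric.ball x D, ‖curl v z‖ ^ 2 = ∫ z in ⋃ x ∈ S, Metric.ball x D, ‖curl v z‖ ^ 2 :=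
    (integral_biUnion_finset S (fun x _ => measurableSet_ball) hdisj (fun x _ => hωint.integrableOn)).symm
  have hle : ∑ x ∈ S, ∫ z in Metric.ball x D, ‖curl v z‖ ^ 2 ≤ Zb := by
    rw [hsum]
    exact (setIntegral_le_integral hωint (Eventually.of_forall fun z => sq_nonneg _)).trans hZ
  have hge : (S.card : ℝ) * c ≤ ∑ x ∈ S, ∫ z in Metric.ball x D, ‖curl v z‖ ^ 2 := by
    rw [← nsmul_eq_mul, ← Finset.sum_const]
    exact Finset.sum_le_sum fun x hx => hfloor v hv hdiv hv1 hDv hZ h1 hgr x (hS x hx)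
  have hcard : (S.card : ℝ) ≤ Zb / c := by
    rw [le_div_iff₀ hc]; linarith
  exact_mod_cast Nat.cast_le.1 ((hcard.trans (Nat.le_ceil _)) : (S.card : ℝ) ≤ (⌈Zb / c⌉₊ : ℝ))

end Crowd

end NearExtremalTransiencePerFlow.LerayPincer

end Summit.NavierStokesRegularity.NavierStokesRegularity.Theorems

end
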